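import Summits.HubbardSuperconductivity.HubbardSuperconductivity.Theses.NoGo
import Summits.HubbardSuperconductivity.HubbardSuperconductivity.Theorems.NoGoSingletPairSpinAlgebra
import Summits.HubbardSuperconductivity.HubbardSuperconductivity.Theorems.NoGoNogoThesis

/-!
# Route NoGo — crux 5: a singlet pair field annihilates saturated ferromagnets

Prover file closing item `stmt-HubbardSuperconductivity-0172`
(`Summit.HubbardSuperconductivity.HubbardSuperconductivity.Theses.NoGo.NogoSingletPairKillsSaturatedFM`):
for every form factor `g`, every side `L ≠ 0`, every `N` and every `N`-particle torus state `ψ`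
with maximal total spin, `S² ψ = (N/2)(N/2 + 1) ψ`, one has `Δ_g ψ = pairField g L ψ = 0`.

Proof: the `SU(2)` selection rule `mulVec_eq_zero_of_commute_spinSq_of_saturated` — an operator `B`
commuting with `S²`, lowering the particle number by two and killing `0`-particle vectors annihilates
every `N`-particle `ψ` with `S² ψ = (N/2)(N/2+1) ψ`, because `B ψ` is an `(N-2)`-particle
`S²`-eigenvector with eigenvalue `(N/2)(N/2+1) > ((N-2)/2)((N-2)/2+1)` and the spin bound
`eq_zero_of_isNParticle_of_spinSq_mulVec` (helper file `NoGoSingletPairSpinAlgebra`) applies. Both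
`localPair g L x` and `pairField g L = Σ_x localPair g L x` are linear combinations of singlet pairs
`c_{x↑} c_{y↓} - c_{x↓} c_{y↑}`, which commute with `S²` (`spinSq_commute_singletPair`, helper file).

Corollaries: the local form `localPair_mulVec_eq_zero_of_saturated`; the vanishing of the two-point
function `pairFieldCorr_succ_eq_zero_of_saturated` (no pair-field LRO of ANY symmetry along
saturated-ferromagnetic members); and the kernel-checked form of the route's plan for crux 3,
`nogoNagaokaWindow_of_saturatedFerromagnetism`: `NogoNagaokaWindow` follows from finite-density
saturated (Nagaoka) ferromagnetism of the `(2⌊(1-δ)L²/2⌋, S^z = 0)` sector ground states for all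
large `L` in a window `U > U₁`, `0 < δ < δ₁` (that ferromagnetic input is OPEN: Tasaki 1998 p. 21).

Sources: H. Tasaki, Prog. Theor. Phys. 99 (1998) 489, p. 20 (an `S_tot = S_max` state is killed by
every operator containing `c_{·↓}` after a spin rotation — replaced here by the `su(2)` selection
rule), p. 21 (finite-density Nagaoka ferromagnetism is open); D. J. Scalapino, Phys. Rep. 250 (1995)
329, §2 (the pair field); E. H. Lieb, PRL 62 (1989) 1201. Folklore.
-/

namespace Summit.HubbardSuperconductivity.HubbardSuperconductivity.Theses.NoGo

open scoped BigOperators Topology Manifold Classical MeasureTheory ProbabilityTheory Matrix InnerProductSpace ComplexConjugate ContinuousMap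
open Filter Set Function TopologicalSpace MeasureTheory

/-- **Record of the replaced/dropped route item `NogoSingletPairKillsSaturatedFM`** = stmt-HubbardSuperconductivity-0172 (ledger signature verbatim, in
the route file's namespace and `open` context; NOT a route item): after `nogoSingletPairKillsSaturatedFM_proof` (below) closed the
item `proved`, the route repair (`restate` under a new name, or `drop`) removed
this constant from the gate-written Theses file, while the Theorems file below — append-only,
statement text fixed — still names it ("Unknown identifier" in the full builds of 2026-08-16).
Re-declared here under its original fully-qualified name and definiens solely so that this record
keeps elaborating. TRUE (proved below). The route detached it at rev 7 to break the _holds import cycle. -/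
def NogoSingletPairKillsSaturatedFM : Prop :=
  ∀ (g : Literature.Probability.LatticeModels.Site 2 → ℝ) (L : ℕ) [NeZero L] (N : ℕ) (ψ : Literature.MathematicalPhysics.QuantumLattice.Fock (Literature.MathematicalPhysics.QuantumLattice.Orb (Literature.MathematicalPhysics.QuantumLattice.FermionTorus 2 L))), Literature.MathematicalPhysics.QuantumLattice.IsNParticle N ψ → Matrix.mulVec Literature.MathematicalPhysics.QuantumLattice.spinSq ψ = (((N : ℝ) / 2 * ((N : ℝ) / 2 + 1) : ℝ) : ℂ) • ψ → Matrix.mulVec (Literature.MathematicalPhysics.QuantumLattice.pairField g L) ψ = 0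

end Summit.HubbardSuperconductivity.HubbardSuperconductivity.Theses.NoGo

namespace Summit.HubbardSuperconductivity.NoGo

open Matrix Finset Literature.MathematicalPhysics.QuantumLattice
open scoped ComplexOrder

noncomputable section

/-! ### Singlet two-body annihilators kill saturated ferromagnets -/

section Selection

variable {Λ : Type*} [LinearOrder Λ] [Fintype Λ]

/-- **`SU(2)` selection rule.** Let `B` commute with `S²`, lower the particle number by two and
kill `0`-particle vectors (e.g. any linear combination of singlet pairs `c_{x↑}c_{y↓} - c_{x↓}c_{y↑}`).
Then `B ψ = 0` for every `N`-particle `ψ` of maximal spin `S² ψ = (N/2)(N/2+1) ψ`: `B ψ` is an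
`(N-2)`-particle `S²`-eigenvector with eigenvalue `(N/2)(N/2+1) > ((N-2)/2)((N-2)/2+1)`.
Tasaki, Prog. Theor. Phys. 99 (1998) 489, p. 20; Lieb, PRL 62 (1989) 1201. [folklore] -/
theorem mulVec_eq_zero_of_commute_spinSq_of_saturated {B : Matrix (Finset (Orb Λ)) (Finset (Orb Λ)) ℂ}
    (hB : Commute spinSq B)
    (hB2 : ∀ {N : ℕ} {ψ : Fock (Orb Λ)}, IsNParticle N ψ → IsNParticle (N - 2) (B *ᵥ ψ))
    (hB0 : ∀ {ψ : Fock (Orb Λ)}, IsNParticle 0 ψ → B *ᵥ ψ = 0) {N : ℕ} {ψ : Fock (Orb Λ)}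
    (hN : IsNParticle N ψ) (hS : spinSq *ᵥ ψ = (((N : ℝ) / 2 * ((N : ℝ) / 2 + 1) : ℝ) : ℂ) • ψ) :
    B *ᵥ ψ = 0 := by
  rcases Nat.eq_zero_or_pos N with rfl | hNpos
  · exact hB0 hN
  · refine eq_zero_of_isNParticle_of_spinSq_mulVec (lam := (N : ℝ) / 2 * ((N : ℝ) / 2 + 1))
      (hB2 hN) ?_ ?_
    · rw [Matrix.mulVec_mulVec, hB.eq, ← Matrix.mulVec_mulVec, hS, Matrix.mulVec_smul]
    · rcases Nat.lt_or_ge N 2 with h2 | h2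
      · have hN1 : N = 1 := by omega
        subst hN1; norm_num
      · have hN' : (0 : ℝ) < N := by exact_mod_cast hNpos
        rw [Nat.cast_sub h2]; push_cast; nlinarith

end Selection

/-! ### The pair field on the torus -/

section PairField

open Literature.Probability.LatticeModels

variable (g : Site 2 → ℝ) (L : ℕ) [NeZero L]

/-- `[S², P_x] = 0` for the local singlet pair operator `localPair g L x`. Tasaki (1998) p. 20. [folklore] -/
theorem spinSq_commute_localPair (x : TorusSite 2 L) :
    Commute (spinSq : Matrix (Finset (Orb (FermionTorus 2 L))) _ ℂ) (localPair g L x) := by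
  rw [localPair]
  exact Commute.sum_right _ _ _ fun e _ => (spinSq_commute_singletPair _ _).smul_right _

/-- `[S², Δ_g] = 0` for the pair field `pairField g L = Σ_x P_x`. Tasaki (1998) p. 20. [folklore] -/
theorem spinSq_commute_pairField :
    Commute (spinSq : Matrix (Finset (Orb (FermionTorus 2 L))) _ ℂ) (pairField g L) := by
  rw [pairField]
  exact Commute.sum_right _ _ _ fun x _ => spinSq_commute_localPair g L x

/-- `P_x ψ` written out as a linear combination of the vectors `c_{x↑} c_{y↓} ψ - c_{x↓} c_{y↑} ψ`.
Scalapino, Phys. Rep. 250 (1995) 329, §2, eq. (2.2). [folklore] -/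
theorem localPair_mulVec_eq_sum (x : TorusSite 2 L) (ψ : Fock (Orb (FermionTorus 2 L))) :
    localPair g L x *ᵥ ψ =
      ∑ e ∈ insert 0 unitSteps, ((g e / Real.sqrt 2 : ℝ) : ℂ) •
        (annihilation (orb (FermionTorus.ofTorusSite x) 0) *ᵥ
            (annihilation (orb (FermionTorus.ofTorusSite (x + Torus.proj L e)) 1) *ᵥ ψ) -
          annihilation (orb (FermionTorus.ofTorusSite x) 1) *ᵥ
            (annihilation (orb (FermionTorus.ofTorusSite (x + Torus.proj L e)) 0) *ᵥ ψ)) := by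
  simp only [localPair, Matrix.sum_mulVec, Matrix.smul_mulVec, Matrix.sub_mulVec,
    ← Matrix.mulVec_mulVec]

/-- `Δ_g ψ = Σ_x P_x ψ`. Scalapino, Phys. Rep. 250 (1995) 329, §2, eq. (2.2). [folklore] -/
theorem pairField_mulVec_eq_sum (ψ : Fock (Orb (FermionTorus 2 L))) :
    pairField g L *ᵥ ψ = ∑ x : TorusSite 2 L, localPair g L x *ᵥ ψ := by
  rw [pairField, Matrix.sum_mulVec]

/-- `P_x` removes two particles: for an `N`-particle `ψ`, `P_x ψ` is an `(N-2)`-particle vector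
(natural-number subtraction; for `N ≤ 1` the vector is in fact `0`). Tasaki (2020) §9.2. [folklore] -/
theorem isNParticle_localPair_mulVec (x : TorusSite 2 L) {N : ℕ} {ψ : Fock (Orb (FermionTorus 2 L))}
    (hψ : IsNParticle N ψ) : IsNParticle (N - 2) (localPair g L x *ᵥ ψ) := by
  have hmem : ∀ i j : Orb (FermionTorus 2 L),
      annihilation i *ᵥ (annihilation j *ᵥ ψ) ∈ nParticleSubmodule (ι := Orb (FermionTorus 2 L)) (N - 2) := by
    intro i j
    rw [mem_nParticleSubmodule_iff, show N - 2 = N - 1 - 1 by omega]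
    exact PosSemidefTrace.isNParticle_annihilation_mulVec
      (PosSemidefTrace.isNParticle_annihilation_mulVec hψ j) i
  rw [← mem_nParticleSubmodule_iff, localPair_mulVec_eq_sum]
  exact Submodule.sum_mem _ fun e _ => Submodule.smul_mem _ _ (Submodule.sub_mem _ (hmem _ _) (hmem _ _))

/-- `Δ_g` removes two particles. Tasaki (2020) §9.2. [folklore] -/
theorem isNParticle_pairField_mulVec {N : ℕ} {ψ : Fock (Orb (FermionTorus 2 L))}
    (hψ : IsNParticle N ψ) : IsNParticle (N - 2) (pairField g L *ᵥ ψ) := by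
  rw [← mem_nParticleSubmodule_iff, pairField_mulVec_eq_sum]
  exact Submodule.sum_mem _ fun x _ =>
    (mem_nParticleSubmodule_iff _ _).2 (isNParticle_localPair_mulVec g L x hψ)

/-- `P_x` kills `0`-particle vectors. Bratteli–Robinson II §5.2.2. [folklore] -/
theorem localPair_mulVec_eq_zero_of_isNParticle_zero (x : TorusSite 2 L)
    {ψ : Fock (Orb (FermionTorus 2 L))} (hψ : IsNParticle 0 ψ) : localPair g L x *ᵥ ψ = 0 := by
  simp only [localPair_mulVec_eq_sum, annihilation_mulVec_eq_zero_of_isNParticle_zero hψ,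
    Matrix.mulVec_zero, sub_self, smul_zero, Finset.sum_const_zero]

/-- `Δ_g` kills `0`-particle vectors. Bratteli–Robinson II §5.2.2. [folklore] -/
theorem pairField_mulVec_eq_zero_of_isNParticle_zero {ψ : Fock (Orb (FermionTorus 2 L))}
    (hψ : IsNParticle 0 ψ) : pairField g L *ᵥ ψ = 0 := by
  simp only [pairField_mulVec_eq_sum, localPair_mulVec_eq_zero_of_isNParticle_zero g L _ hψ,
    Finset.sum_const_zero]

/-- **Local form of crux 5**: every local singlet pair operator annihilates a saturated ferromagnet,
`P_x ψ = 0` whenever `ψ` is an `N`-particle state with `S² ψ = (N/2)(N/2+1) ψ`.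
Tasaki, Prog. Theor. Phys. 99 (1998) 489, p. 20. [folklore] -/
theorem localPair_mulVec_eq_zero_of_saturated (x : TorusSite 2 L) {N : ℕ}
    {ψ : Fock (Orb (FermionTorus 2 L))} (hN : IsNParticle N ψ)
    (hS : spinSq *ᵥ ψ = (((N : ℝ) / 2 * ((N : ℝ) / 2 + 1) : ℝ) : ℂ) • ψ) :
    localPair g L x *ᵥ ψ = 0 :=
  mulVec_eq_zero_of_commute_spinSq_of_saturated (spinSq_commute_localPair g L x)
    (fun h => isNParticle_localPair_mulVec g L x h)
    (fun h => localPair_mulVec_eq_zero_of_isNParticle_zero g L x h) hN hS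

/-- **Crux 5, explicit form**: the pair field annihilates a saturated ferromagnet, `Δ_g ψ = 0`.
Tasaki, Prog. Theor. Phys. 99 (1998) 489, p. 20. [folklore] -/
theorem pairField_mulVec_eq_zero_of_saturated {N : ℕ} {ψ : Fock (Orb (FermionTorus 2 L))}
    (hN : IsNParticle N ψ) (hS : spinSq *ᵥ ψ = (((N : ℝ) / 2 * ((N : ℝ) / 2 + 1) : ℝ) : ℂ) • ψ) :
    pairField g L *ᵥ ψ = 0 :=
  mulVec_eq_zero_of_commute_spinSq_of_saturated (spinSq_commute_pairField g L)
    (fun h => isNParticle_pairField_mulVec g L h)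
    (fun h => pairField_mulVec_eq_zero_of_isNParticle_zero g L h) hN hS

end PairField

section Corr

open Literature.Probability.LatticeModels

/-- **Crux 5 for the two-point function**: along a family of torus states whose member at side
`L + 1` is a saturated ferromagnet, the pair-field correlation `pairFieldCorr g ψ (L+1)` vanishes
identically (`⟨ψ, P_x† P_y ψ⟩ = ⟨P_x ψ, P_y ψ⟩`-type identity with `P_y ψ = 0`). Hence saturated
ferromagnetic ground-state sequences carry no pair-field LRO of any symmetry.
Tasaki, Prog. Theor. Phys. 99 (1998) 489, p. 20; Scalapino, Phys. Rep. 250 (1995) 329, §2. [folklore] -/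
theorem pairFieldCorr_succ_eq_zero_of_saturated (g : Site 2 → ℝ)
    (ψ : ∀ L, Fock (Orb (FermionTorus 2 L))) (L : ℕ) {N : ℕ} (hN : IsNParticle N (ψ (L + 1)))
    (hS : spinSq *ᵥ ψ (L + 1) = (((N : ℝ) / 2 * ((N : ℝ) / 2 + 1) : ℝ) : ℂ) • ψ (L + 1))
    (x y : TorusSite 2 (L + 1)) : pairFieldCorr g ψ (L + 1) x y = 0 := by
  rw [pairFieldCorr_succ, Literature.MathematicalPhysics.QuantumLattice.expect, ← Matrix.mulVec_mulVec,
    localPair_mulVec_eq_zero_of_saturated g (L + 1) y hN hS, Matrix.mulVec_zero, dotProduct_zero,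
    Complex.zero_re]

end Corr

/-! ### The item -/

/-- **Route NoGo, crux 5 (`stmt-HubbardSuperconductivity-0172`): a singlet pair field annihilates
every saturated ferromagnet.** If `ψ` is an `N`-particle state on the fermionic torus of side `L`
with `S² ψ = (N/2)(N/2+1) ψ`, then `pairField g L ψ = 0` for every form factor `g`; hence
`pairFieldCorr g` vanishes identically along saturated-ferromagnetic ground-state sequences
(`pairFieldCorr_succ_eq_zero_of_saturated`). Proof: `Δ_g` commutes with `S²` and removes two
particles, and `S² ≤ ((N-2)/2)((N-2)/2+1) < (N/2)(N/2+1)` on `(N-2)`-particle vectors.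
Tasaki, Prog. Theor. Phys. 99 (1998) 489, p. 20; Lieb, PRL 62 (1989) 1201. [folklore] -/
theorem nogoSingletPairKillsSaturatedFM_proof :
    Summit.HubbardSuperconductivity.HubbardSuperconductivity.Theses.NoGo.NogoSingletPairKillsSaturatedFM := by
  unfold Summit.HubbardSuperconductivity.HubbardSuperconductivity.Theses.NoGo.NogoSingletPairKillsSaturatedFM
  intro g L _ N ψ hN hS
  exact pairField_mulVec_eq_zero_of_saturated g L hN hS


/-! ### Crux 3 from crux 5: the Nagaoka window follows from finite-density saturated ferromagnetism -/

section Nagaoka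

open Filter Literature.Probability.LatticeModels

/-- Normalised sector ground states with an optional saturation certificate: if (under the side
condition `P`) the `(2n, S^z = 0)` sector of `hubbardTorus 2 L 1 U` contains a saturated
ferromagnetic ground state (`S² ψ = n(n+1) ψ`), pick and normalise it; otherwise pick any
normalised sector ground state (`exists_unit_groundStateInSector_hubbardTorus`). Lieb, PRL 62
(1989) 1201; Tasaki (2020) §2.2. [folklore] -/
theorem exists_unit_groundStateInSector_saturated (L : ℕ) (U : ℝ) {n : ℕ} (hn : n ≤ L ^ 2)
    (P : Prop) (hP : P → ∃ ψ : Fock (Orb (FermionTorus 2 L)),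
      IsGroundStateInSector (hubbardTorus 2 L 1 U) (2 * n) 0 ψ ∧
        spinSq *ᵥ ψ = (((n : ℝ) * ((n : ℝ) + 1) : ℝ) : ℂ) • ψ) :
    ∃ ψ : Fock (Orb (FermionTorus 2 L)), star ψ ⬝ᵥ ψ = 1 ∧
      IsGroundStateInSector (hubbardTorus 2 L 1 U) (2 * n) 0 ψ ∧
        (P → spinSq *ᵥ ψ = (((n : ℝ) * ((n : ℝ) + 1) : ℝ) : ℂ) • ψ) := by
  by_cases h : P
  · obtain ⟨ψ, hgs, hS⟩ := hP h
    obtain ⟨c, hc, hc1⟩ := exists_smul_unit hgs.2.1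
    refine ⟨c • ψ, hc1, isGroundStateInSector_smul _ _ _ hgs hc, fun _ => ?_⟩
    rw [mulVec_smul, hS, smul_comm]
  · obtain ⟨ψ, h1, h2⟩ := exists_unit_groundStateInSector_hubbardTorus L 1 U hn
    exact ⟨ψ, h1, h2, fun hp => absurd hp h⟩

/-- On a saturated ferromagnetic `2n`-particle member `ψ (L+1)` the term of the LRO sequence
`(L+1)⁻⁴ re ⟨ψ_{L+1}, Δ_g† Δ_g ψ_{L+1}⟩` vanishes (crux 5: `Δ_g ψ_{L+1} = 0`).
Tasaki, Prog. Theor. Phys. 99 (1998) 489, p. 20. [folklore] -/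
theorem pairFieldSeq_eq_zero_of_saturated (g : Site 2 → ℝ) (ψ : ∀ L, Fock (Orb (FermionTorus 2 L)))
    (L : ℕ) {n : ℕ} (hN : IsNParticle (2 * n) (ψ (L + 1)))
    (hS : spinSq *ᵥ ψ (L + 1) = (((n : ℝ) * ((n : ℝ) + 1) : ℝ) : ℂ) • ψ (L + 1)) :
    (Literature.MathematicalPhysics.QuantumLattice.expect
        ((pairField g (L + 1))ᴴ * pairField g (L + 1)) (ψ (L + 1))).re / ((L + 1 : ℕ) : ℝ) ^ 4 = 0 := by
  have hS' : spinSq *ᵥ ψ (L + 1) =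
      (((((2 * n : ℕ) : ℝ) / 2) * ((((2 * n : ℕ) : ℝ) / 2) + 1) : ℝ) : ℂ) • ψ (L + 1) := by
    rw [hS]; congr 2; push_cast; ring
  rw [Literature.MathematicalPhysics.QuantumLattice.expect, ← Matrix.mulVec_mulVec,
    pairField_mulVec_eq_zero_of_saturated g (L + 1) hN hS', Matrix.mulVec_zero, dotProduct_zero,
    Complex.zero_re, zero_div]

/-- **Crux 3 (`NogoNagaokaWindow`) from crux 5 and finite-density Nagaoka ferromagnetism.**
If for some window `U > U₁`, `0 < δ < δ₁` and all sufficiently large sides `L` the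
`(2⌊(1-δ)L²/2⌋, S^z = 0)` sector of the pure Hubbard model on `(ℤ/Lℤ)²` contains a SATURATED
ferromagnetic ground state (`S = N_L/2`; the `S^z = 0` member of the top multiplet), then some
normalised sector ground-state sequence has no `d_{x²-y²}` pair-field LRO — in fact its LRO sequence
is eventually `0` (`pairFieldSeq_eq_zero_of_saturated`). The ferromagnetic hypothesis is OPEN at
positive hole density and finite `U` (Nagaoka 1966 / Tasaki 1989: one hole, `U = ∞`; Tasaki, Prog.
Theor. Phys. 99 (1998) 489, p. 21); this theorem is the kernel-checked form of the route's claim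
"crux 3 = Nagaoka input + crux 5". [folklore] -/
theorem nogoNagaokaWindow_of_saturatedFerromagnetism
    (hFM : ∃ U₁ : ℝ, ∃ δ₁ ∈ Set.Ioo (0:ℝ) 1, ∀ U : ℝ, U₁ < U → ∀ δ ∈ Set.Ioo (0:ℝ) δ₁,
      ∀ᶠ L : ℕ in atTop, ∃ ψ : Fock (Orb (FermionTorus 2 L)),
        IsGroundStateInSector (hubbardTorus 2 L 1 U) (2 * ⌊(1 - δ) * (L : ℝ) ^ 2 / 2⌋₊) 0 ψ ∧
          spinSq *ᵥ ψ = (((⌊(1 - δ) * (L : ℝ) ^ 2 / 2⌋₊ : ℝ) *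
            ((⌊(1 - δ) * (L : ℝ) ^ 2 / 2⌋₊ : ℝ) + 1) : ℝ) : ℂ) • ψ) :
    Summit.HubbardSuperconductivity.HubbardSuperconductivity.Theses.NoGo.NogoNagaokaWindow := by
  obtain ⟨U₁, δ₁, hδ₁, h⟩ := hFM
  refine ⟨U₁, δ₁, hδ₁, fun U hU δ hδ => ?_⟩
  obtain ⟨L₀, hL₀⟩ := eventually_atTop.1 (h U hU δ hδ)
  have hδ' : (-1 : ℝ) ≤ δ := by linarith [hδ.1]
  choose ψ hψ using fun L => exists_unit_groundStateInSector_saturated L U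
    (floor_pairNumber_le δ hδ' L) (L₀ ≤ L) (fun hL => hL₀ L hL)
  refine ⟨fun L => 2 * ⌊(1 - δ) * (L : ℝ) ^ 2 / 2⌋₊, ψ, fun L => ⟨rfl, (hψ L).1, (hψ L).2.1⟩, ?_⟩
  rw [not_hasPairFieldLRO_iff_of_hyp dWaveFormFactor fun L => ⟨(hψ L).1, (hψ L).2.1⟩]
  have hzero : ∀ᶠ L : ℕ in atTop,
      (Literature.MathematicalPhysics.QuantumLattice.expect
          ((pairField dWaveFormFactor (L + 1))ᴴ * pairField dWaveFormFactor (L + 1))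
          (ψ (L + 1))).re / ((L + 1 : ℕ) : ℝ) ^ 4 = (fun _ : ℕ => (0 : ℝ)) L := by
    refine eventually_atTop.2 ⟨L₀, fun L hL => ?_⟩
    exact pairFieldSeq_eq_zero_of_saturated dWaveFormFactor ψ L
      ((mem_szSector_iff _ _ _).1 (hψ (L + 1)).2.1.1).1 ((hψ (L + 1)).2.2 (by omega))
  rw [liminf_congr hzero, liminf_const]

end Nagaoka

end

end Summit.HubbardSuperconductivity.NoGo
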